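import Literature.NumberTheory.Sieve.QuadraticRootsPrimeModuliDFISieveReindex
import Literature.NumberTheory.Sieve.QuadraticRootsPrimeModuliDFISieveEstimates
import HarnessLib

/-!
# Duke–Friedlander–Iwaniec 1995, §6: the partition `y_k` and the bilinear part of Lemmas 1–3

Topic `Literature/NumberTheory/Sieve`.  Third layer towards the discharge of
`Literature.NumberTheory.Sieve.dukeFriedlanderIwaniec1995_theorem5` (W. Duke, J. B. Friedlander,
H. Iwaniec, Ann. of Math. 141 (1995), §6 pp. 434–437).  After Buchstab twice and the exchange of the
two primes (`…DFISieveReindex`), the double sum is `∑_{w ≤ q < z} ∑_{q < p < z} S(C_{pq}, q)`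
(quotient convention).  This file treats the range `w ≤ q < y` exactly as on pp. 434–436: with the
points (30) `y_k = y (w/y)^{k/K}` (here `y_k = y·exp(−k log(y/w)/K)`), `0 ≤ k ≤ K`, every such `q`
lies in a unique `[y_{k+1}, y_k)` (`DFI1995.exists_partition_index`); the `p`-sum splits at `y_k`, and for
`p ≥ y_k` Buchstab gives `S(C_{pq}, q) = S(C_{pq}, y_k) + ∑_{q ≤ r < y_k} S(C_{pqr}, r)`.  This file
provides the pieces: the points `y_k` and the partition, the short sums
`∑_{y_{k+1} ≤ p < y_k} 1/p ≤ Δ₀ = 1/w + log(y/w)/K` (the paper's `Δ ≤ c(w^{−1} + K^{−1} log(y/w))`,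
`DFI1995.sum_inv_short_le`), the crude bounds (27) `|S(C_{pq}, ·)| ≤ 4X/(pq)`, `|S(C_{pqr}, ·)| ≤ 8X/(pqr)`
(`X = x(1 + log x)`), and the identification of one fibre of the middle piece with a general bilinear
form (33): `∑_{q ∈ Q} ∑_{y_k ≤ p < z} S(C_{pq}, y_k) = DFI1995.sieveR₂ c α β x w y` with `β = 1_Q` and
`α_m = #{(p, m') : y_k ≤ p < z prime, (m', P(y_k)) = 1, pm' = m} ≤ ω(m)` (`DFI1995.exists_sieveR₂_eq`),
so that hypothesis (35) applies to it.  The summation over `q` is carried out in `…DFISieveMiddle`.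
Everything here is proved.

## References

* W. Duke, J. B. Friedlander, H. Iwaniec, Ann. of Math. (2) 141 (1995), 423–441, §6 pp. 434–437,
  Lemma 1 (26), (27), (30), Lemma 2 (31), (33), (35). [cite: DukeFriedlanderIwaniec1995, §6 Lemmas 1–2]
-/

namespace Literature.NumberTheory.Sieve

open scoped BigOperators
open Finset Real

namespace DFI1995

noncomputable section

/-! ### The points `y_k` -/

/-- `y_0 = y`. [folklore] -/
theorem yk_zero (y w : ℝ) (K : ℕ) : (y * Real.exp (-(((0 : ℕ) : ℝ) * (Real.log (y / w) / (K : ℝ))))) = y := by simp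

/-- `y_K = w` (`y, w > 0`, `K ≥ 1`). [folklore] -/
theorem yk_self {y w : ℝ} (hy : 0 < y) (hw : 0 < w) {K : ℕ} (hK : 0 < K) : (y * Real.exp (-((K : ℝ) * (Real.log (y / w) / (K : ℝ))))) = w := by
  have hK' : (K : ℝ) ≠ 0 := by exact_mod_cast hK.ne'
  rw [mul_div_cancel₀ _ hK', Real.exp_neg, Real.exp_log (div_pos hy hw)]
  field_simp

/-- `0 < y_k`. [folklore] -/
theorem yk_pos {y : ℝ} (hy : 0 < y) (w : ℝ) (K k : ℕ) : 0 < (y * Real.exp (-((k : ℝ) * (Real.log (y / w) / (K : ℝ))))) :=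
  mul_pos hy (Real.exp_pos _)

/-- `y_k` decreases in `k` when `w ≤ y`. [folklore] -/
theorem yk_antitone {y w : ℝ} (hy : 0 < y) (hw : 0 < w) (hwy : w ≤ y) (K : ℕ) {k k' : ℕ} (hkk' : k ≤ k') :
    (y * Real.exp (-((k' : ℝ) * (Real.log (y / w) / (K : ℝ))))) ≤ (y * Real.exp (-((k : ℝ) * (Real.log (y / w) / (K : ℝ))))) := by
  have hL : 0 ≤ Real.log (y / w) / K :=
    div_nonneg (Real.log_nonneg ((one_le_div hw).2 hwy)) (Nat.cast_nonneg K)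
  refine mul_le_mul_of_nonneg_left (Real.exp_le_exp.2 ?_) hy.le
  have : (k : ℝ) ≤ k' := by exact_mod_cast hkk'
  nlinarith

/-- `y_k ≤ y`. [folklore] -/
theorem yk_le {y w : ℝ} (hy : 0 < y) (hw : 0 < w) (hwy : w ≤ y) (K k : ℕ) : (y * Real.exp (-((k : ℝ) * (Real.log (y / w) / (K : ℝ))))) ≤ y := by
  have h := yk_antitone hy hw hwy K (Nat.zero_le k)
  rwa [yk_zero] at h

/-- `w ≤ y_k` for `k ≤ K`. [folklore] -/
theorem le_yk {y w : ℝ} (hy : 0 < y) (hw : 0 < w) (hwy : w ≤ y) {K k : ℕ} (hK : 0 < K) (hk : k ≤ K) :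
    w ≤ (y * Real.exp (-((k : ℝ) * (Real.log (y / w) / (K : ℝ))))) := by
  have h := yk_antitone hy hw hwy K hk
  rwa [yk_self hy hw hK] at h

/-- `log (y_k / y_{k+1}) = log(y/w)/K`. [folklore] -/
theorem log_yk_div_yk_succ {y : ℝ} (hy : 0 < y) (w : ℝ) (K k : ℕ) :
    Real.log ((y * Real.exp (-((k : ℝ) * (Real.log (y / w) / (K : ℝ))))) / (y * Real.exp (-(((k + 1 : ℕ) : ℝ) * (Real.log (y / w) / (K : ℝ)))))) = Real.log (y / w) / K := by
  rw [mul_div_mul_left _ _ hy.ne', ← Real.exp_sub, Real.log_exp]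
  push_cast
  ring

/-- **The partition** (p. 434: "we further partition the range `w ≤ p < y` into short segments by
appropriately selected points `w = y_K < ⋯ < y_1 < y_0 = y`"): every real `t` with `w ≤ t < y` lies
in `[y_{k+1}, y_k)` for some `k < K` (namely `k = ⌈K log(y/t)/log(y/w)⌉ − 1`).
[cite: DukeFriedlanderIwaniec1995, §6 p. 434] -/
theorem exists_partition_index {y w : ℝ} (hw : 0 < w) (hwy : w < y) {K : ℕ} (hK : 0 < K) {t : ℝ}
    (hwt : w ≤ t) (hty : t < y) :
    ∃ k : ℕ, k < K ∧ (y * Real.exp (-(((k + 1 : ℕ) : ℝ) * (Real.log (y / w) / (K : ℝ))))) ≤ t ∧ t < (y * Real.exp (-((k : ℝ) * (Real.log (y / w) / (K : ℝ))))) := by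
  have hy : 0 < y := hw.trans hwy
  have ht : 0 < t := hw.trans_le hwt
  have hK0 : (0 : ℝ) < K := by exact_mod_cast hK
  set L : ℝ := Real.log (y / w) / K with hL
  have hlog_yw : 0 < Real.log (y / w) := Real.log_pos ((one_lt_div hw).2 hwy)
  have hL0 : 0 < L := div_pos hlog_yw hK0
  have hlog_yt : 0 < Real.log (y / t) := Real.log_pos ((one_lt_div ht).2 hty)
  set s : ℝ := Real.log (y / t) / L with hs
  have hs0 : 0 < s := div_pos hlog_yt hL0
  have hsK : s ≤ K := by
    rw [hs, div_le_iff₀ hL0, hL, mul_div_cancel₀ _ hK0.ne']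
    exact Real.log_le_log (div_pos hy ht) (div_le_div_of_nonneg_left hy.le hw hwt)
  refine ⟨⌈s⌉₊ - 1, ?_, ?_, ?_⟩
  · have h1 : ⌈s⌉₊ ≤ K := Nat.ceil_le.2 hsK
    have h2 : 0 < ⌈s⌉₊ := Nat.ceil_pos.2 hs0
    omega
  · -- `y_{k+1} ≤ t` iff `log(y/t) ≤ (k+1) L` iff `s ≤ k + 1`
    have hk1 : s ≤ ((⌈s⌉₊ - 1 + 1 : ℕ) : ℝ) := by
      rw [Nat.sub_add_cancel (Nat.ceil_pos.2 hs0)]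
      exact Nat.le_ceil s
    have h1 : Real.log (y / t) ≤ ((⌈s⌉₊ - 1 + 1 : ℕ) : ℝ) * L := by
      rwa [hs, div_le_iff₀ hL0] at hk1
    -- `y * exp(-(k+1)L) ≤ t`
    rw [← Real.log_le_log_iff (mul_pos hy (Real.exp_pos _)) ht, Real.log_mul hy.ne' (Real.exp_pos _).ne',
      Real.log_exp]
    rw [Real.log_div hy.ne' ht.ne'] at h1
    linarith
  · have hk2 : (((⌈s⌉₊ - 1 : ℕ)) : ℝ) < s := by
      have h := Nat.ceil_lt_add_one hs0.le
      have h2 : 0 < ⌈s⌉₊ := Nat.ceil_pos.2 hs0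
      push_cast [Nat.cast_sub h2, Nat.cast_one]
      linarith
    have h1 : (((⌈s⌉₊ - 1 : ℕ)) : ℝ) * L < Real.log (y / t) := by
      rwa [hs, lt_div_iff₀ hL0] at hk2
    rw [← Real.log_lt_log_iff ht (mul_pos hy (Real.exp_pos _)), Real.log_mul hy.ne' (Real.exp_pos _).ne',
      Real.log_exp]
    rw [Real.log_div hy.ne' ht.ne'] at h1
    linarith

/-- **The short sums of `1/p`** (p. 436): if every element of `S ⊆ ℕ` lies in `[y_{k+1}, y_k)` with
`k < K` and `1 ≤ w ≤ y`, then `∑_{p ∈ S} 1/p ≤ Δ₀ = 1/w + log(y/w)/K`.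
[cite: DukeFriedlanderIwaniec1995, §6 p. 436] -/
theorem sum_inv_short_le {y w : ℝ} (hw : 1 ≤ w) (hwy : w ≤ y) {K k : ℕ} (hK : 0 < K) (hk : k < K)
    {S : Finset ℕ} (hS : ∀ n ∈ S, (y * Real.exp (-(((k + 1 : ℕ) : ℝ) * (Real.log (y / w) / (K : ℝ))))) ≤ (n : ℝ) ∧ (n : ℝ) < (y * Real.exp (-((k : ℝ) * (Real.log (y / w) / (K : ℝ)))))) :
    ∑ n ∈ S, (n : ℝ)⁻¹ ≤ w⁻¹ + Real.log (y / w) / K := by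
  have hw0 : 0 < w := by linarith
  have hy : 0 < y := by linarith
  have hu : w ≤ (y * Real.exp (-(((k + 1 : ℕ) : ℝ) * (Real.log (y / w) / (K : ℝ))))) := le_yk hy hw0 hwy hK hk
  have huv : (y * Real.exp (-(((k + 1 : ℕ) : ℝ) * (Real.log (y / w) / (K : ℝ))))) ≤ (y * Real.exp (-((k : ℝ) * (Real.log (y / w) / (K : ℝ))))) := yk_antitone hy hw0 hwy K (Nat.le_succ k)
  calc ∑ n ∈ S, (n : ℝ)⁻¹ ≤ ((y * Real.exp (-(((k + 1 : ℕ) : ℝ) * (Real.log (y / w) / (K : ℝ))))))⁻¹ + Real.log ((y * Real.exp (-((k : ℝ) * (Real.log (y / w) / (K : ℝ))))) / (y * Real.exp (-(((k + 1 : ℕ) : ℝ) * (Real.log (y / w) / (K : ℝ)))))) :=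
        sum_inv_le_of_forall_mem_Ico (hw.trans hu) huv hS
    _ ≤ w⁻¹ + Real.log (y / w) / K := by
        rw [log_yk_div_yk_succ hy]
        have := inv_anti₀ hw0 hu
        linarith

/-! ### Crude bounds for `S(C_{pq}, q)` and `S(C_{pqr}, r)` -/

/-- `τ(p) = 2` for a prime `p`. [folklore] -/
theorem card_divisors_prime {p : ℕ} (hp : p.Prime) : p.divisors.card = 2 := by
  rw [Nat.Prime.divisors hp, Finset.card_pair hp.ne_one.symm]

/-- (27) for `d = pq`: `|S(C_{pq}, t)| ≤ 4 X/(pq)`, `X = x(1 + log x)`, for primes `p, q`.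
[cite: DukeFriedlanderIwaniec1995, §6 (27)] -/
theorem norm_siftedQ_two_primes_le {c : ℕ → ℂ} (hc : ∀ n : ℕ, 1 ≤ n → ‖c n‖ ≤ (Nat.divisors n).card)
    {x : ℝ} (hx : 1 ≤ x) {p q : ℕ} (hp : p.Prime) (hq : q.Prime) (t : ℝ) :
    ‖siftedQ c x (p * q) t‖ ≤ 4 * (x * (1 + Real.log x)) * ((p : ℝ)⁻¹ * (q : ℝ)⁻¹) := by
  have hpq : 1 ≤ p * q := Nat.mul_pos hp.pos hq.pos
  rw [siftedQ_eq_sum_filter]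
  refine (norm_sum_quotSeq_le hc hpq hx (Finset.filter_subset _ _)).trans ?_
  have hτ : ((p * q).divisors.card : ℝ) ≤ 4 := by
    have h := card_divisors_mul_le p q
    rw [card_divisors_prime hp, card_divisors_prime hq] at h
    exact_mod_cast h
  have hp0 : (0 : ℝ) < p := by exact_mod_cast hp.pos
  have hq0 : (0 : ℝ) < q := by exact_mod_cast hq.pos
  have hlog : 0 ≤ 1 + Real.log x := by have := Real.log_nonneg hx; linarith
  have e : (x / ((p * q : ℕ) : ℝ)) * (1 + Real.log x) = (x * (1 + Real.log x)) * ((p : ℝ)⁻¹ * (q : ℝ)⁻¹) := by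
    push_cast; field_simp
  calc ((p * q).divisors.card : ℝ) * (x / ((p * q : ℕ) : ℝ)) * (1 + Real.log x)
      = ((p * q).divisors.card : ℝ) * ((x / ((p * q : ℕ) : ℝ)) * (1 + Real.log x)) := by ring
    _ ≤ 4 * ((x / ((p * q : ℕ) : ℝ)) * (1 + Real.log x)) := by
        refine mul_le_mul_of_nonneg_right hτ ?_
        have : (0 : ℝ) ≤ x / ((p * q : ℕ) : ℝ) := by positivity
        positivity
    _ = 4 * (x * (1 + Real.log x)) * ((p : ℝ)⁻¹ * (q : ℝ)⁻¹) := by rw [e]; ring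

/-- (27) for `d = pqr`: `|S(C_{pqr}, t)| ≤ 8 X/(pqr)` for primes `p, q, r`.
[cite: DukeFriedlanderIwaniec1995, §6 (27)] -/
theorem norm_siftedQ_three_primes_le {c : ℕ → ℂ} (hc : ∀ n : ℕ, 1 ≤ n → ‖c n‖ ≤ (Nat.divisors n).card)
    {x : ℝ} (hx : 1 ≤ x) {p q r : ℕ} (hp : p.Prime) (hq : q.Prime) (hr : r.Prime) (t : ℝ) :
    ‖siftedQ c x (p * q * r) t‖ ≤
      8 * (x * (1 + Real.log x)) * ((p : ℝ)⁻¹ * (q : ℝ)⁻¹ * (r : ℝ)⁻¹) := by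
  have hpqr : 1 ≤ p * q * r := Nat.mul_pos (Nat.mul_pos hp.pos hq.pos) hr.pos
  rw [siftedQ_eq_sum_filter]
  refine (norm_sum_quotSeq_le hc hpqr hx (Finset.filter_subset _ _)).trans ?_
  have hτ : ((p * q * r).divisors.card : ℝ) ≤ 8 := by
    have h := (card_divisors_mul_le (p * q) r).trans
      (Nat.mul_le_mul_right _ (card_divisors_mul_le p q))
    rw [card_divisors_prime hp, card_divisors_prime hq, card_divisors_prime hr] at h
    exact_mod_cast h
  have hp0 : (0 : ℝ) < p := by exact_mod_cast hp.pos
  have hq0 : (0 : ℝ) < q := by exact_mod_cast hq.pos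
  have hr0 : (0 : ℝ) < r := by exact_mod_cast hr.pos
  have hlog : 0 ≤ 1 + Real.log x := by have := Real.log_nonneg hx; linarith
  have e : (x / ((p * q * r : ℕ) : ℝ)) * (1 + Real.log x) =
      (x * (1 + Real.log x)) * ((p : ℝ)⁻¹ * (q : ℝ)⁻¹ * (r : ℝ)⁻¹) := by
    push_cast; field_simp
  calc ((p * q * r).divisors.card : ℝ) * (x / ((p * q * r : ℕ) : ℝ)) * (1 + Real.log x)
      = ((p * q * r).divisors.card : ℝ) * ((x / ((p * q * r : ℕ) : ℝ)) * (1 + Real.log x)) := by ring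
    _ ≤ 8 * ((x / ((p * q * r : ℕ) : ℝ)) * (1 + Real.log x)) := by
        refine mul_le_mul_of_nonneg_right hτ ?_
        have : (0 : ℝ) ≤ x / ((p * q * r : ℕ) : ℝ) := by positivity
        positivity
    _ = 8 * (x * (1 + Real.log x)) * ((p : ℝ)⁻¹ * (q : ℝ)⁻¹ * (r : ℝ)⁻¹) := by rw [e]; ring

/-! ### One fibre of the middle piece is a general bilinear form (33) -/

/-- **`∑_{q ∈ Q} ∑_{u ≤ p < z} S(C_{pq}, u)` is a general bilinear form `R(w, y)`** (33): for a set `Q`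
of primes `q` with `w ≤ q < y`, `q < u` (in the proof of Lemma 1: the primes of one segment
`[y_{k+1}, y_k)`, `u = y_k`) and `y ≤ x`, there are coefficients `|α_m| ≤ ω(m)`, `|β_n| ≤ 1`, `β`
supported on primes (namely `β = 1_Q`, `α_m = #{(p, m') : u ≤ p < z prime, (m', P(u)) = 1, pm' = m}`),
with `DFI1995.sieveR₂ c α β x w y = ∑_{q ∈ Q} ∑_{u ≤ p < z} S(C_{pq}, u)`.
[cite: DukeFriedlanderIwaniec1995, §6 (33) and p. 437] -/
theorem exists_sieveR₂_eq (c : ℕ → ℂ) {x w y z u : ℝ} (hyx : y ≤ x) {Q : Finset ℕ}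
    (hQ : ∀ q ∈ Q, q.Prime ∧ w ≤ (q : ℝ) ∧ (q : ℝ) < y ∧ (q : ℝ) < u) :
    ∃ α β : ℕ → ℂ, (∀ m : ℕ, ‖α m‖ ≤ ArithmeticFunction.cardDistinctFactors m) ∧
      (∀ n : ℕ, ‖β n‖ ≤ 1) ∧ (∀ n : ℕ, ¬ n.Prime → β n = 0) ∧
      sieveR₂ c α β x w y = ∑ q ∈ Q, ∑ p ∈ primesIco u z, siftedQ c x (p * q) u := by
  classical
  set T : Finset (ℕ × ℕ) := (primesIco u z ×ˢ Icc 1 ⌊x⌋₊).filter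
    (fun pm : ℕ × ℕ => pm.2.Coprime (primesProdBelow u)) with hT
  refine ⟨fun m => (((T.filter (fun pm : ℕ × ℕ => pm.1 * pm.2 = m)).card : ℕ) : ℂ),
    fun n => if n ∈ Q then 1 else 0, ?_, ?_, ?_, ?_⟩
  · -- `|α_m| ≤ ω(m)`: `(p, m') ↦ p` injects the fibre into the prime factors of `m`
    intro m
    have hω : ArithmeticFunction.cardDistinctFactors m = m.primeFactors.card := by
      rw [ArithmeticFunction.cardDistinctFactors_apply, ← List.card_toFinset]; rfl
    rw [hω, Complex.norm_natCast, Nat.cast_le]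
    refine Finset.card_le_card_of_injOn Prod.fst (fun pm hpm => ?_) (fun pm hpm pm' hpm' h => ?_)
    · rw [Finset.mem_coe, Finset.mem_filter, hT, Finset.mem_filter, Finset.mem_product, mem_primesIco,
        Finset.mem_Icc] at hpm
      obtain ⟨⟨⟨⟨hp, -, -⟩, hm1, -⟩, -⟩, hpm⟩ := hpm
      rw [Finset.mem_coe, Nat.mem_primeFactors]
      refine ⟨hp, ⟨pm.2, hpm.symm⟩, ?_⟩
      rw [← hpm]; exact Nat.mul_ne_zero hp.ne_zero (by omega)
    · rw [Finset.mem_coe, Finset.mem_filter, hT, Finset.mem_filter, Finset.mem_product, mem_primesIco] at hpm hpm'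
      have hp0 : pm.1 ≠ 0 := hpm.1.1.1.1.ne_zero
      have h2 : pm.1 * pm.2 = pm.1 * pm'.2 := by rw [hpm.2, ← hpm'.2, ← h]
      exact Prod.ext h (Nat.eq_of_mul_eq_mul_left (Nat.pos_of_ne_zero hp0) h2)
  · intro n
    dsimp only
    split_ifs <;> simp
  · intro n hn
    show (if n ∈ Q then (1 : ℂ) else 0) = 0
    rw [if_neg]
    exact fun h => hn (hQ n h).1
  · -- the identity
    have hQsub : Q ⊆ (Icc 1 ⌊x⌋₊).filter (fun n : ℕ => w ≤ (n : ℝ) ∧ (n : ℝ) < y) := by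
      intro q hq
      obtain ⟨hqp, hwq, hqy, -⟩ := hQ q hq
      rw [Finset.mem_filter, Finset.mem_Icc]
      exact ⟨⟨hqp.one_le, Nat.le_floor (hqy.le.trans hyx)⟩, hwq, hqy⟩
    unfold sieveR₂
    -- Step 1: `β = 1_Q`
    have h1 : ∀ n ∈ (Icc 1 ⌊x⌋₊).filter (fun n : ℕ => w ≤ (n : ℝ) ∧ (n : ℝ) < y),
        (if n ∈ Q then (1 : ℂ) else 0) *
          ∑ m ∈ (Icc 1 (⌊x⌋₊ / n)).filter (fun m : ℕ => Nat.Coprime m n),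
            ((((T.filter (fun pm : ℕ × ℕ => pm.1 * pm.2 = m)).card : ℕ) : ℂ)) * c (m * n) =
        if n ∈ Q then ∑ m ∈ (Icc 1 (⌊x⌋₊ / n)).filter (fun m : ℕ => Nat.Coprime m n),
            ((((T.filter (fun pm : ℕ × ℕ => pm.1 * pm.2 = m)).card : ℕ) : ℂ)) * c (m * n) else 0 := by
      intro n _
      split_ifs <;> simp
    rw [Finset.sum_congr rfl h1, Finset.sum_ite_mem, Finset.inter_eq_right.2 hQsub]
    refine Finset.sum_congr rfl fun q hq => ?_
    obtain ⟨hqp, hwq, hqy, hqu⟩ := hQ q hq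
    have hqP : q ∣ primesProdBelow u := (dvd_primesProdBelow_iff hqp u).2 hqu
    -- Step 2: `α_m c_{mq} = ∑_{(p, m') : pm' = m} c_{pm'q}` and un-fibre
    have h2 : ∀ m ∈ (Icc 1 (⌊x⌋₊ / q)).filter (fun m : ℕ => Nat.Coprime m q),
        ((((T.filter (fun pm : ℕ × ℕ => pm.1 * pm.2 = m)).card : ℕ) : ℂ)) * c (m * q) =
          ∑ pm ∈ T.filter (fun pm : ℕ × ℕ => pm.1 * pm.2 = m), c (m * q) := by
      intro m _
      rw [Finset.sum_const, nsmul_eq_mul]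
    rw [Finset.sum_congr rfl h2,
      Finset.sum_fiberwise_eq_sum_filter' T _ (fun pm : ℕ × ℕ => pm.1 * pm.2) (fun m => c (m * q)),
      hT, Finset.filter_filter, Finset.sum_filter, Finset.sum_product]
    refine Finset.sum_congr rfl fun p hp => ?_
    obtain ⟨hpp, hup, -⟩ := mem_primesIco.1 hp
    have hqltp : q < p := by exact_mod_cast hqu.trans_le hup
    have hpq : Nat.Coprime p q := (Nat.coprime_primes hpp hqp).2 (Nat.ne_of_gt hqltp)
    rw [siftedQ_eq_sum_filter, ← Finset.sum_filter]
    refine Finset.sum_congr ?_ fun m _ => by rw [mul_right_comm]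
    -- the index sets agree
    ext m
    simp only [Finset.mem_filter, Finset.mem_Icc]
    constructor
    · rintro ⟨⟨hm1, -⟩, hcop, ⟨-, hle⟩, -⟩
      refine ⟨⟨hm1, ?_⟩, hcop⟩
      rw [mul_comm p q, ← Nat.div_div_eq_div_mul]
      exact (Nat.le_div_iff_mul_le hpp.pos).2 (by rwa [mul_comm] at hle)
    · rintro ⟨⟨hm1, hle⟩, hcop⟩
      have hle' : m * p ≤ ⌊x⌋₊ / q := by
        rw [mul_comm p q, ← Nat.div_div_eq_div_mul] at hle
        exact (Nat.le_div_iff_mul_le hpp.pos).1 hle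
      refine ⟨⟨hm1, ?_⟩, hcop, ⟨Nat.mul_pos hpp.pos (by omega), by rwa [mul_comm] at hle'⟩,
        Nat.Coprime.mul_left hpq (Nat.Coprime.coprime_dvd_right hqP hcop)⟩
      exact hle.trans (Nat.div_le_self _ _)

end

end DFI1995

end Literature.NumberTheory.Sieve
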